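import Summits.QuantumFields.YangMills.Theorems.BalabanUVNodesN19InEdgesC1
import Summits.QuantumFields.YangMills.Theorems.BalabanUVNodesN16HolderMSDefs
import Summits.QuantumFields.YangMills.Theorems.BalabanUVNodesN16HolderShape
import HarnessLib

/-!
# Route «BalabanUVNodes», cluster K4 «SpineRates» — THE IN-EDGE N16 → N19 IN THE η-NORMALISED C¹ CURRENCY FROM THE MULTI-SCALE β-ROOT (repair R-β″): n19-e's
# liaison twin with N16's input `CovRootHolderMS … β` and the rate letter `θ^{2β∕(1+β)} ≤ θ₃ < 1` — NE7's gauge-domination profile for EVERY `β ∈ (0, 1]`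
# (generation 3's `N19LiaisonC1Holder` needed `β ∈ (2∕3, 1]`, base `θ^{3β−2}`)

Cell `pub-ymgap`, seat `pub-ymgap-dag-n16-c` (R134 fan-out seat, strategy s1; HUMAN RULING D-0062; chair R424 venue), generation 4, file 37 — the N19-side CONSUMER
of repair R-β″ (the last consumer of the third covariant conjunct), twin of generation 3's file 18 `N19LiaisonC1Holder` (N19's lineage did not TAKE the β version
either; INTENT-10 on the bus, one declarer = this seat).  `--supports stmt-QuantumFields-19912 --as helper` (K3‴ `SpineGivenEndpointR13`, route rev 16).  `bears_on:
R4∕N16 · out-edge N16 → N19`.  Located item: `HOME/pub-ymgap-dag-n16-c/LOCATED-N16-HOLDER-PIN.md`, census row R-β″ (ADDENDUM 5).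

WHAT THIS FILE PROVES (kernel, theorems only, 0 `def`, 0 sorry): `ne3LiaisonC1_of_covRootHolderMS`.
HONEST FRAMING: binder bookkeeping over landed theorems (n19-e's profile proof, n16-c's MS consumer END); the MS β-root, N07's `LeafH3sup` and the domination
convention `hdomC1` are HYPOTHESES; nothing of Bałaban's proved; N16 ∕ N19 NOT discharged; count-neutral; one finite four-torus at fixed ε — NOT ℝ⁴, NOT infinite
volume, NOT OS, NOT a mass gap, NOT Clay.
-/

set_option autoImplicit false

noncomputable section

open scoped BigOperators Matrix Matrix.Norms.L2Operator
open Finset MeasureTheory NormedSpace Metric Set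

namespace Summit.QuantumFields.YangMills.BalabanUVNodes.N19LiaisonC1HolderMS

open Literature.MathematicalPhysics.QuantumFieldTheory.Balaban1983to89
open B7Prop1Explicit B7Prop2Explicit
open T4AveragingDeficitWall (IsSkewDir vary Ad)
open T4OutputRate (Carriers Functional)
open T4EtaRateMin (Readings ActionRate LocalRate NE3Shape)
open T4RateLiaison (GaugeDominated)
open T4TowerRateComposition (PolyLipGrowth)
open Summit.QuantumFields.BalabanUV.T4Continuum
open AveragingDeficitPeriodicCounting (IsPeriodicDir)
open AveragingDeficitDualResidual (dualC1 dualC2)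
open AveragingDeficitDerivWallProof (wallConst)
open MinimalActionSandwich (IsMinimiser minAct)
open MinimalActionRate (Regular sfClass)
open MinimalActionRefine (RegularSup gradConst gradConst_nonneg)
open NE3EnergyShapes (IsUnitarySite IsPeriodicSite)
open NE3EnergyWeightedCovShape (NE3EnergyRateWCov)
open NE3.LeafIndexSockets (LeafH3sup)
open NE7EtaBackgroundRefineThresholds (thresholds_four)
open Summit.QuantumFields.YangMills.BalabanUVNodes.N19InEdgesAtRecord (fit_of_fit_one)
open Summit.QuantumFields.YangMills.BalabanUVNodes.N19InEdgesC1 (value_weight_eq inv_le_theta)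
open Summit.QuantumFields.YangMills.BalabanUVNodes.N16HolderMSDefs (CovRootHolderMS closeness_of_covRootHolderMS covRootHolder_of_covRootHolderMS)
open Summit.QuantumFields.YangMills.BalabanUVNodes.N16HolderMultiScale (rateMS_eq_margin_mul)
open Summit.QuantumFields.YangMills.BalabanUVNodes.N16HolderShape (ne3Shape_of_covRootHolder)

variable {n : Type*} [Fintype n] [DecidableEq n] [Nonempty n]

/-- **THE MULTI-SCALE β-ROOT BY NAME ⟶ `NE3Shape ∧ GaugeDominated` UNDER THE η-NORMALISED C¹ DOMINATION CONVENTION, RATE BASE `θ^{2β∕(1+β)}`** (`d = 4`;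
`L ≥ 2`, `Nper ≥ 1`; `0 ≤ β ≤ 1`; regime, `h3`, selection, readings, `hdomC1` VERBATIM as in n19-e's `N19InEdgesC1.ne3LiaisonC1_of_covRoot` and generation 3's
`N19LiaisonC1Holder.ne3LiaisonC1_of_covRootHolder`; N16's input `h16 : CovRootHolderMS 4 (sfClass 4 L Nper ε) L Nper b (gradConst 4 c) C Λ₁ Λ₂' β dom` — the
MULTI-SCALE β-root of repair R-β″ (`N16HolderMSDefs`); rate letter `θ^{2β∕(1+β)} ≤ θ₃ < 1`, available for EVERY `β > 0` (no window): `∃ C₃ loc, 0 ≤ C₃ ∧ NE3Shape … C₃ θ₃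
∧ GaugeDominated … uA uB`.  Proof: generation 3's, with the action half from `ne3Shape_of_covRootHolder` (exponent-blind) over `covRootHolder_of_covRootHolderMS`, the
profile step from `closeness_of_covRootHolderMS` ((Gᶜ) at `(θ^k)^{(12+14β)∕(1+β)}`) and `(L^k)²·(θ^k)^{(12+14β)∕(1+β)} = (θ^{2β∕(1+β)})^k` (`rateMS_eq_margin_mul`).
NE3 ∕ N16 ∕ N07 ∕ NE7 NOT proved. [folklore] -/
theorem ne3LiaisonC1_of_covRootHolderMS {L Nper : ℕ} (hL : 2 ≤ L) (hN : 1 ≤ Nper) {ε ε₁ b c t C Λ₁ Λ₂' β : ℝ} (hβ0 : 0 ≤ β) (hβ1 : β ≤ 1)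
    (hb : 0 ≤ b) (hc : 0 ≤ c) (hbt : b ≤ t) (hct : c ≤ t) (hC : 0 ≤ C)
    (hsmall : (2 : ℝ) ^ 91 * (L : ℝ) ^ 17 * t ≤ 1) (hεt : (2 : ℝ) ^ 76 * (L : ℝ) ^ 12 * t ≤ ε)
    (hε1 : 16 * C0 4 * ε ≤ 3) (hε2 : 1024 * (4 + 1) * (4 + 4) * (L : ℝ) ^ 2 * ε ≤ 1)
    (hε₁ : ε₁ ≤ 1 / 4) (hε₁b : ε₁ ≤ b) (hε₁c : 4 * ε₁ ≤ c)
    {dom : Set (Site 4 → Fin 4 → (Matrix n n ℂ)ˣ)} (hdom : dom ⊆ sfClass 4 L Nper ε₁ 0)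
    (h16 : CovRootHolderMS 4 (sfClass 4 L Nper ε) L Nper b (gradConst 4 c) C Λ₁ Λ₂' β dom)
    (h3 : LeafH3sup 4 L Nper ε b c dom)
    (sel : ℕ → (Site 4 → Fin 4 → (Matrix n n ℂ)ˣ) → (Site 4 → Fin 4 → (Matrix n n ℂ)ˣ))
    (hsel : ∀ V ∈ dom, ∀ k : ℕ, IsMinimiser 4 (sfClass 4 L Nper ε) L Nper k V (sel k V))
    (hreg : ∀ V ∈ dom, ∀ k : ℕ, RegularSup 4 L Nper b c k (sel k V))
    {θ γ₃ l₁ θ₃ : ℝ} (hθ : 0 < θ) (hθ6 : θ ^ 6 = ((L : ℝ))⁻¹) (hΛ₂' : 0 ≤ Λ₂') (hγ₃ : 0 < γ₃)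
    (hγ3 : C * (wallConst 4 L * (Nper : ℝ) ^ 2 * (Real.sqrt (gradConst 4 c) * dualC2 4 L + 2 * b ^ 2 * dualC1 4 L)) ≤ γ₃ ^ 3)
    (hl₁ : 0 < l₁) (hΛl₁ : Λ₁ ≤ l₁ ^ 3) (hfit : γ₃ * θ ^ 2 ≤ l₁ * Nper)
    (hθ₃θ : θ ^ ((2 : ℝ) * β / (1 + β)) ≤ θ₃) (hθ₃1 : θ₃ < 1)
    {ι' X' : Type} (Rd : Readings ι' X') (rd : ι' → (Site 4 → Fin 4 → (Matrix n n ℂ)ˣ)) (hrd : ∀ v ∈ Rd.dom, rd v ∈ dom)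
    (hact : ∀ k, ∀ v ∈ Rd.dom, Rd.act k v = minAct 4 (sfClass 4 L Nper ε) L Nper k (rd v)) (hvol : (Nper : ℝ) ^ 4 ≤ Rd.vol)
    {Car : Carriers} (uA : ℕ → ι' → Car.BgA) (uB : ℕ → ι' → Car.BgB) {k₀ : ℕ} (hk₀ : 1 ≤ k₀)
    (hdomC1 : ∀ K : ℕ, ∀ v ∈ Rd.dom, ∀ (u : Site 4 → (Matrix n n ℂ)ˣ) (Z : Site 4 → Fin 4 → Matrix n n ℂ) (M : ℝ),
      IsUnitarySite u → IsPeriodicSite u ((Nper * L ^ (k₀ + K) : ℕ) : ℤ) → IsSkewDir Z → IsPeriodicDir Z ((Nper * L ^ (k₀ + K) : ℕ) : ℤ) →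
      gaugeAct u (sel (k₀ + K) (rd v)) = vary (rescale L (bavg L (sel (k₀ + K + 1) (rd v)))) Z 1 →
      (∀ (x : Site 4) (κ : Fin 4), (L : ℝ) ^ (k₀ + K) * ‖Z x κ‖ ≤ M) →
      (∀ (x : Site 4) (μ κ : Fin 4), ((L : ℝ) ^ (k₀ + K)) ^ 2 *
          ‖Ad (rescale L (bavg L (sel (k₀ + K + 1) (rd v))) (x + e κ) μ) (Z (x + e μ) κ) - Z x κ‖ ≤ M) →
      Car.gauge (uA K v) (Car.transport (uB K v)) ≤ M) :
    ∃ (C₃ : ℝ) (loc : ℕ → ι' → Unit → ℝ), 0 ≤ C₃ ∧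
      NE3Shape (⟨Rd.dom, Rd.act, loc, Rd.vol, Rd.vol_nonneg⟩ : Readings ι' Unit) C₃ θ₃ ∧
      GaugeDominated (⟨Rd.dom, Rd.act, loc, Rd.vol, Rd.vol_nonneg⟩ : Readings ι' Unit) uA uB := by
  classical
  -- letters
  have hL1 : 1 ≤ L := le_trans (by norm_num) hL
  have hL0 : (0 : ℝ) < L := by exact_mod_cast (show 0 < L by omega)
  have hL1r : (1 : ℝ) ≤ L := by exact_mod_cast hL1
  have hLinv0 : 0 ≤ ((L : ℝ))⁻¹ := inv_nonneg.mpr hL0.le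
  have h6 : θ ^ 6 ≤ 1 := by rw [hθ6]; exact inv_le_one_of_one_le₀ hL1r
  have hθ1 : θ ≤ 1 := (pow_le_one_iff_of_nonneg hθ.le (by norm_num)).mp h6
  -- the per-level base `ρ := θ^{3β−2}` of the β-root's (Gᶜ)∕(C)∕(Q) rates (n16-c `rate_holder_eq_margin_mul`); `θ⁶, θ² ≤ ρ ≤ θ₃ < 1` (`β ≤ 1 ≤ 4∕3`)
  set ρ : ℝ := θ ^ ((2 : ℝ) * β / (1 + β)) with hρdef
  have hρ0 : 0 ≤ ρ := Real.rpow_nonneg hθ.le _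
  have hρ1 : ρ ≤ 1 := hθ₃θ.trans hθ₃1.le
  have hexp1 : (2 : ℝ) * β / (1 + β) ≤ 1 := by rw [div_le_one (by linarith)]; linarith
  have hρ2 : θ ^ 2 ≤ ρ := by
    rw [hρdef, ← Real.rpow_natCast θ 2]
    exact Real.rpow_le_rpow_of_exponent_ge hθ hθ1 (by push_cast; linarith)
  have hρ6 : θ ^ 6 ≤ ρ := by
    rw [hρdef, ← Real.rpow_natCast θ 6]
    exact Real.rpow_le_rpow_of_exponent_ge hθ hθ1 (by push_cast; linarith)
  have hθ₃L : ((L : ℝ))⁻¹ ≤ θ₃ := by rw [← hθ6]; exact hρ6.trans hθ₃θ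
  have hθ₃0 : 0 ≤ θ₃ := hLinv0.trans hθ₃L
  have hρθ₃K : ∀ K : ℕ, ρ ^ (k₀ + K) ≤ θ₃ ^ K := fun K =>
    calc ρ ^ (k₀ + K) ≤ ρ ^ K := pow_le_pow_of_le_one hρ0 hρ1 (Nat.le_add_left K k₀)
      _ ≤ θ₃ ^ K := pow_le_pow_left₀ hρ0 hθ₃θ K
  set G : ℝ := 8 * l₁ ^ 2 * γ₃ + (32 * l₁ ^ 2 * γ₃ + 2 * Λ₂') with hGdef
  have hG1 : 0 ≤ 8 * l₁ ^ 2 * γ₃ := by positivity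
  have hG2 : 0 ≤ 32 * l₁ ^ 2 * γ₃ + 2 * Λ₂' := by positivity
  have hG0 : 0 ≤ G := add_nonneg hG1 hG2
  -- the k-free averaging condition on `b` from threshold (ii): `52428800·L²·t ≤ 1`
  have ht0 : 0 ≤ t := hb.trans hbt
  obtain ⟨-, hT2, -⟩ := thresholds_four hL1 ht0 hsmall
  have hbs : 512 * (4 + 1) * (4 + 4) * (L : ℝ) ^ 2 * b ≤ 1 := by
    have e : (2 : ℝ) ^ 15 * (((4 : ℕ) : ℝ) + 1) ^ 2 * (((4 : ℕ) : ℝ) + 4) ^ 2 * (L : ℝ) ^ 2 * t = 52428800 * ((L : ℝ) ^ 2 * t) := by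
      push_cast; ring
    have h2 : 52428800 * ((L : ℝ) ^ 2 * t) ≤ 1 := by rw [← e]; exact hT2
    have hL2 : (0 : ℝ) ≤ (L : ℝ) ^ 2 := by positivity
    have h3' : (L : ℝ) ^ 2 * b ≤ (L : ℝ) ^ 2 * t := mul_le_mul_of_nonneg_left hbt hL2
    have h4 : 0 ≤ (L : ℝ) ^ 2 * b := mul_nonneg hL2 hb
    nlinarith
  -- ACTION half of NE3 from the β-root and N07's interface (β-blind: n16-c `ne3Shape_of_covRootHolder` (b))
  obtain ⟨-, hall⟩ := ne3Shape_of_covRootHolder hL hN hb hc hbt hct hC hsmall hεt hε1 hε2 hε₁ hε₁b hε₁c hdom (covRootHolder_of_covRootHolderMS hL1 h16) h3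
  obtain ⟨C', hC'0, hsh⟩ := hall sel (fun V hV k => hsel V hV k) (fun V hV k => hreg V hV k)
  -- the geometric gauge profile in the C¹ currency
  refine ⟨max C' G, fun K _ _ => ∑ i ∈ range K, G * θ₃ ^ i, hC'0.trans (le_max_left _ _), ⟨hθ₃0, hθ₃1, ?_, ?_⟩, ?_⟩
  · -- action rate of the re-localised family: `|A_{k+1} − A_k| ≤ C′ L^{−k} Nper⁴ ≤ max C′ G · θ₃^k · Rd.vol`
    intro k v hv
    have hA : |minAct 4 (sfClass 4 L Nper ε) L Nper (k + 1) (rd v) - minAct 4 (sfClass 4 L Nper ε) L Nper k (rd v)|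
        ≤ C' * ((L : ℝ))⁻¹ ^ k * (Nper : ℝ) ^ 4 := hsh.action k (rd v) (hrd v hv)
    show |Rd.act (k + 1) v - Rd.act k v| ≤ max C' G * θ₃ ^ k * Rd.vol
    rw [hact (k + 1) v hv, hact k v hv]
    refine hA.trans (mul_le_mul (mul_le_mul (le_max_left _ _) (pow_le_pow_left₀ hLinv0 hθ₃L k) (pow_nonneg hLinv0 k)
      (hC'0.trans (le_max_left _ _))) hvol (by positivity) ?_)
    exact mul_nonneg (hC'0.trans (le_max_left _ _)) (pow_nonneg hθ₃0 k)
  · -- pointwise rate of the profile: increments `G·θ₃^k ≤ max C′ G · θ₃^k`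
    intro k v _ x
    show |(∑ i ∈ range (k + 1), G * θ₃ ^ i) - ∑ i ∈ range k, G * θ₃ ^ i| ≤ max C' G * θ₃ ^ k
    rw [Finset.sum_range_succ, add_sub_cancel_left, abs_of_nonneg (mul_nonneg hG0 (pow_nonneg hθ₃0 k))]
    exact mul_le_mul_of_nonneg_right (le_max_right _ _) (pow_nonneg hθ₃0 k)
  · -- the gauge liaison in the C¹ currency: closeness at level `k₀ + K ≥ 1` with (P) AND (Gᶜ), the unit table, then `hdomC1`
    intro K v hv M hM
    have hMge : G * θ₃ ^ K ≤ M := by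
      have h := hM ()
      change |(∑ i ∈ range (K + 1), G * θ₃ ^ i) - ∑ i ∈ range K, G * θ₃ ^ i| ≤ M at h
      rwa [Finset.sum_range_succ, add_sub_cancel_left, abs_of_nonneg (mul_nonneg hG0 (pow_nonneg hθ₃0 K))] at h
    have hk : 1 ≤ k₀ + K := le_trans hk₀ (Nat.le_add_right k₀ K)
    have hfit' : γ₃ * (θ ^ (k₀ + K)) ^ 2 ≤ l₁ * Nper := fit_of_fit_one hγ₃.le hθ.le hθ1 hfit hk
    have hregB : Regular 4 L Nper b (gradConst 4 c) (k₀ + K + 1) (sel (k₀ + K + 1) (rd v)) :=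
      (hreg (rd v) (hrd v hv) (k₀ + K + 1)).regular
    obtain ⟨u, Z, hu, hup, hZs, hZp, hrepr, hZ, hZg, -, -⟩ :=
      closeness_of_covRootHolderMS hL hN hθ hθ6 hb hbs (gradConst_nonneg (d := 4) c) hC hΛ₂' hβ0 hβ1 h16 hγ₃ hγ3 hl₁ hΛl₁ hk hfit'
        (hrd v hv) (hsel (rd v) (hrd v hv) (k₀ + K)) (hsel (rd v) (hrd v hv) (k₀ + K + 1)) hregB
    have hunit1 : (L : ℝ) ^ (k₀ + K) * θ ^ (8 * (k₀ + K)) = θ ^ (2 * (k₀ + K)) := value_weight_eq hL0 hθ6 _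
    have hunit2 : ((L : ℝ) ^ (k₀ + K)) ^ 2 * (θ ^ (k₀ + K)) ^ (((12 : ℝ) + 14 * β) / (1 + β)) = ρ ^ (k₀ + K) := by
      rw [rateMS_eq_margin_mul hL1 hθ hθ6 hβ0 (k₀ + K), ← mul_assoc, ← mul_pow, ← mul_pow, mul_inv_cancel₀ hL0.ne', one_pow, one_pow, one_mul]
    have h2k : θ ^ (2 * (k₀ + K)) ≤ θ₃ ^ K := by
      rw [pow_mul]
      exact (pow_le_pow_left₀ (pow_nonneg hθ.le 2) hρ2 (k₀ + K)).trans (hρθ₃K K)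
    have hval : ∀ (x : Site 4) (κ : Fin 4), (L : ℝ) ^ (k₀ + K) * ‖Z x κ‖ ≤ M := fun x κ =>
      calc (L : ℝ) ^ (k₀ + K) * ‖Z x κ‖ ≤ (L : ℝ) ^ (k₀ + K) * (8 * l₁ ^ 2 * γ₃ * θ ^ (8 * (k₀ + K))) :=
            mul_le_mul_of_nonneg_left (hZ x κ) (pow_nonneg hL0.le _)
        _ = 8 * l₁ ^ 2 * γ₃ * θ ^ (2 * (k₀ + K)) := by rw [← hunit1]; ring
        _ ≤ 8 * l₁ ^ 2 * γ₃ * θ₃ ^ K := mul_le_mul_of_nonneg_left h2k hG1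
        _ ≤ G * θ₃ ^ K := mul_le_mul_of_nonneg_right (le_add_of_nonneg_right hG2) (pow_nonneg hθ₃0 K)
        _ ≤ M := hMge
    have hgrad : ∀ (x : Site 4) (μ κ : Fin 4), ((L : ℝ) ^ (k₀ + K)) ^ 2 *
        ‖Ad (rescale L (bavg L (sel (k₀ + K + 1) (rd v))) (x + e κ) μ) (Z (x + e μ) κ) - Z x κ‖ ≤ M := fun x μ κ =>
      calc ((L : ℝ) ^ (k₀ + K)) ^ 2 * ‖Ad (rescale L (bavg L (sel (k₀ + K + 1) (rd v))) (x + e κ) μ) (Z (x + e μ) κ) - Z x κ‖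
            ≤ ((L : ℝ) ^ (k₀ + K)) ^ 2 * ((32 * l₁ ^ 2 * γ₃ + 2 * Λ₂') * (θ ^ (k₀ + K)) ^ (((12 : ℝ) + 14 * β) / (1 + β))) :=
            mul_le_mul_of_nonneg_left (hZg x μ κ) (by positivity)
        _ = (32 * l₁ ^ 2 * γ₃ + 2 * Λ₂') * ρ ^ (k₀ + K) := by rw [← hunit2]; ring
        _ ≤ (32 * l₁ ^ 2 * γ₃ + 2 * Λ₂') * θ₃ ^ K := mul_le_mul_of_nonneg_left (hρθ₃K K) hG2
        _ ≤ G * θ₃ ^ K := mul_le_mul_of_nonneg_right (le_add_of_nonneg_left hG1) (pow_nonneg hθ₃0 K)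
        _ ≤ M := hMge
    exact hdomC1 K v hv u Z M hu hup hZs hZp hrepr hval hgrad

end Summit.QuantumFields.YangMills.BalabanUVNodes.N19LiaisonC1HolderMS

end
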